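import Mathlib
import Summits.Ventures.PercRepro2.Defs
import Summits.Ventures.PercRepro2.Independence
import Summits.Ventures.PercRepro2.Harris
import Summits.Ventures.PercRepro2.Graph
import Summits.Ventures.PercRepro2.OneColourSwitch
import Summits.Ventures.PercRepro2.M9ClusterAvoidHarris
import Summits.Ventures.PercRepro2.M9SubcubeHarris

/-!
# Harris on the exploration fibre of a cluster (blind cell PercRepro2, p3 g37, 2026-08-29;
`proofs/P3-POCKETRK.md` §5″ Step 3, kernel plan K5)

Explore the `Y`-cluster `C = C_Y(d; ω₀)` of a vertex `d`: the fibre `F(ω₀)` = the colourings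
agreeing with `ω₀` on every edge touching `C` (the edges off `C` free).  On the fibre the cluster
is constant (`cluster_eq_on_fibre`, the domain Markov property), a `Y`-path from a vertex
`p ∉ C` never meets `C` and so uses only free edges; flipping the free edges (an
involution of the fibre) turns it into a `W`-path: `Σ_F 1[p ~_Y q] ≤ Σ_F 1[p ~_W q]`
(`sum_fibre_connY_le_connW`).  With the sub-cube Harris of `M9SubcubeHarris` this gives the
**exploration-fibre Harris**: for every lower set `A` of colourings and every `p ∉ C`,
`Σ_{ω ∈ F(ω₀) ∩ A} σ_pq(ω) ≤ 0` (`sum_fibre_sigma_pq_of_isLowerSet_nonpos`) — the inequality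
behind the unpaired lemma and the dirty clean points of the pocket proof.  Own work; std axioms.
-/

namespace Summit.Ventures.PercRepro2

namespace NoPocket

open Finset Classical OneColourSwitch

variable {V : Type*} {E : Type*} [Fintype E] [DecidableEq E] {ends : E → Sym2 V}

section Fibre

omit [Fintype E] [DecidableEq E] in
/-- The flip of the free edges, on a free edge. -/
lemma flipOff_of_notMem {C : Set V} {ω : Config E} {e : E} (h : e ∉ touches ends C) :
    (if e ∈ touches ends C then ω e else !ω e) = !ω e := by
  simp [h]

omit [Fintype E] [DecidableEq E] in
/-- The flip of the free edges, on an edge touching `C`. -/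
lemma flipOff_of_mem {C : Set V} {ω : Config E} {e : E} (h : e ∈ touches ends C) :
    (if e ∈ touches ends C then ω e else !ω e) = ω e := by
  simp [h]

omit [Fintype E] [DecidableEq E] in
/-- The flip of the free edges is an involution. -/
lemma flipOff_flipOff (C : Set V) (ω : Config E) :
    (fun e => if e ∈ touches ends C then
      (fun e => if e ∈ touches ends C then ω e else !ω e) e else
      !(fun e => if e ∈ touches ends C then ω e else !ω e) e) = ω := by
  funext e
  by_cases h : e ∈ touches ends C
  · simp [h]
  · simp [h]

/-- The flip of the free edges preserves the fibre (it agrees with `ω` on the edges touching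
`C`). -/
lemma flipOff_mem_fibre {C : Set V} {ω₀ ω : Config E}
    (h : ω ∈ univ.filter (fun ω : Config E =>
      ∀ e ∉ univ.filter (fun e => e ∉ touches ends C), ω e = ω₀ e)) :
    (fun e => if e ∈ touches ends C then ω e else !ω e) ∈ univ.filter (fun ω : Config E =>
      ∀ e ∉ univ.filter (fun e => e ∉ touches ends C), ω e = ω₀ e) := by
  simp only [Finset.mem_filter, Finset.mem_univ, true_and, not_not] at h ⊢
  intro e he
  rw [if_pos he]
  exact h e he

omit [Fintype E] [DecidableEq E] in
/-- A `Y`-path from a vertex outside the cluster `C_Y(d; ω)` never meets the cluster and is made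
of free edges: after the flip of the free edges it is a `W`-path. -/
lemma conn_compl_flipOff_of_conn {d p q : V} {ω : Config E} (hp : p ∉ cluster ends ω d)
    (h : Conn ends ω p q) :
    Conn ends (OneColourSwitch.compl
      (fun e => if e ∈ touches ends (cluster ends ω d) then ω e else !ω e)) p q := by
  set C := cluster ends ω d with hC
  have key : q ∈ {x | x ∉ C ∧ Conn ends (OneColourSwitch.compl
      (fun e => if e ∈ touches ends C then ω e else !ω e)) p x} := by
    refine mem_of_conn_of_closed (ends := ends) (ω := ω) ?_ ⟨hp, conn_refl _ _ _⟩ h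
    rintro x ⟨hxC, hxc⟩ y hxy
    obtain ⟨_, e, he, hends⟩ := openGraph_adj.1 hxy
    have hyC : y ∉ C := by
      intro hy
      exact hxC (mem_cluster_of_adj hy hxy.symm)
    have hnt : e ∉ touches ends C := by
      rintro ⟨x', hx', y', hends'⟩
      rw [hends, Sym2.eq_iff] at hends'
      rcases hends' with ⟨rfl, _⟩ | ⟨_, rfl⟩
      · exact hxC hx'
      · exact hyC hx'
    have he' : OneColourSwitch.compl (fun e => if e ∈ touches ends C then ω e else !ω e) e =
        true := by
      simp [OneColourSwitch.compl, hnt, he]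
    exact ⟨hyC, conn_trans hxc (conn_of_openAdj ⟨e, he', hends⟩)⟩
  exact key.2

/-- On the fibre of `ω₀` the cluster of `d` is that of `ω₀` (the domain Markov property). -/
lemma cluster_eq_on_fibre {d : V} {ω₀ ω : Config E}
    (h : ω ∈ univ.filter (fun ω : Config E =>
      ∀ e ∉ univ.filter (fun e => e ∉ touches ends (cluster ends ω₀ d)), ω e = ω₀ e)) :
    cluster ends ω d = cluster ends ω₀ d := by
  simp only [Finset.mem_filter, Finset.mem_univ, true_and, not_not] at h
  exact cluster_eq_of_eqOn_touches (fun e he => (h e he).symm) rfl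

/-- **The flip condition on the exploration fibre**: for `p ∉ C_Y(d; ω₀)`,
`Σ_F 1[p ~_Y q] ≤ Σ_F 1[p ~_W q]`. -/
theorem sum_fibre_connY_le_connW {d p q : V} (ω₀ : Config E) (hp : p ∉ cluster ends ω₀ d) :
    (∑ ω ∈ univ.filter (fun ω : Config E =>
        ∀ e ∉ univ.filter (fun e => e ∉ touches ends (cluster ends ω₀ d)), ω e = ω₀ e),
      if Conn ends ω p q then (1 : ℚ) else 0) ≤
    ∑ ω ∈ univ.filter (fun ω : Config E =>
        ∀ e ∉ univ.filter (fun e => e ∉ touches ends (cluster ends ω₀ d)), ω e = ω₀ e),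
      if Conn ends (OneColourSwitch.compl ω) p q then (1 : ℚ) else 0 := by
  set C := cluster ends ω₀ d with hC
  set F := univ.filter (fun ω : Config E =>
    ∀ e ∉ univ.filter (fun e => e ∉ touches ends C), ω e = ω₀ e) with hF
  -- reindex the right-hand side by the involution «flip the free edges»
  have hre : (∑ ω ∈ F, if Conn ends (OneColourSwitch.compl ω) p q then (1 : ℚ) else 0) =
      ∑ ω ∈ F, if Conn ends (OneColourSwitch.compl
        (fun e => if e ∈ touches ends C then ω e else !ω e)) p q then (1 : ℚ) else 0 := by
    refine (Finset.sum_nbij' (fun ω : Config E => fun e => if e ∈ touches ends C then ω e else !ω e)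
      (fun ω : Config E => fun e => if e ∈ touches ends C then ω e else !ω e)
      ?_ ?_ ?_ ?_ ?_).symm
    · intro ω hω; exact flipOff_mem_fibre hω
    · intro ω hω; exact flipOff_mem_fibre hω
    · intro ω _; exact flipOff_flipOff C ω
    · intro ω _; exact flipOff_flipOff C ω
    · intro ω _; rfl
  rw [hre]
  refine Finset.sum_le_sum fun ω hω => ?_
  by_cases hc : Conn ends ω p q
  · rw [if_pos hc]
    have hpω : p ∉ cluster ends ω d := by rw [cluster_eq_on_fibre hω]; exact hp
    have := conn_compl_flipOff_of_conn hpω hc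
    rw [cluster_eq_on_fibre hω] at this
    rw [if_pos this]
  · rw [if_neg hc]
    split_ifs <;> norm_num

/-- **The exploration-fibre Harris**: explore the `Y`-cluster `C` of `d` in `ω₀`; for every lower
set `A` of colourings and every `p ∉ C`, `Σ_{ω ∈ F(ω₀) ∩ A} σ_pq(ω) ≤ 0`. -/
theorem sum_fibre_sigma_pq_of_isLowerSet_nonpos {d p q : V} (ω₀ : Config E)
    (hp : p ∉ cluster ends ω₀ d) {A : Set (Config E)} (hA : IsLowerSet A) :
    (∑ ω ∈ univ.filter (fun ω : Config E =>
        ∀ e ∉ univ.filter (fun e => e ∉ touches ends (cluster ends ω₀ d)), ω e = ω₀ e),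
      if ω ∈ A then sigma ends ω p q else 0) ≤ 0 :=
  sum_subcube_sigma_pq_of_isLowerSet_nonpos
    (univ.filter (fun e => e ∉ touches ends (cluster ends ω₀ d))) ω₀ hA p q
    (sum_fibre_connY_le_connW ω₀ hp)

end Fibre

end NoPocket

end Summit.Ventures.PercRepro2
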